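import Mathlib.AlgebraicGeometry.AlgClosed.Basic
import Mathlib.AlgebraicGeometry.PullbackCarrier
import Mathlib.Analysis.Complex.Polynomial.Basic
import Mathlib.FieldTheory.RatFunc.AsPolynomial
import Literature.AlgebraicGeometry.Motives.AlgPoints
import HarnessLib

/-!
# When is `X(L)` (in particular `X(ℂ)`) non-empty? (carrier witness for `ComplexPoints`)

`Literature.AlgebraicGeometry.Motives.ComplexPoints X = AlgPoints X ℂ = (Spec ℂ ⟶ X over Spec k)`
is a *parametrised* carrier (`k`, `[Algebra k ℂ]`, `X : SchemeOver k`); it is inhabited for some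
parameters and empty for others. This file settles the question exactly in the range that the
route items use (`S : SchemeOver ℂ` smooth, irreducible; `X` smooth projective):

* `AlgPoints.nonempty_left_of_nonempty`: an `L`-point has an underlying point, so
  `X(L) ≠ ∅ ⇒ X ≠ ∅`; equivalently `AlgPoints.isEmpty_of_isEmpty`: **`X = ∅ ⇒ X(L) = ∅`** — over
  this region every `∀ s : ComplexPoints S, …` item is vacuous and every `∃ s : ComplexPoints S, …`
  item is false (`ComplexPoints_isEmpty`, `ComplexPoints_isEmpty_empty` for the empty `k`-scheme).
* `AlgPoints.nonempty_of_locallyOfFiniteType` (**Hilbert's Nullstellensatz**): if `L ⊇ k` is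
  algebraically closed and `X` is locally of finite type over `k` and non-empty, then `X(L) ≠ ∅`:
  the base change `X_L → Spec L` is locally of finite type and `X_L ≠ ∅` (`Spec L → Spec k` is
  surjective), so `X_L` is a Jacobson space with a closed point, which is `L`-rational
  (Görtz–Wedhorn, Prop. 3.35 and Cor. 3.36; Mathlib `pointOfClosedPoint`), and
  `X(L) = X_L(L)` (Görtz–Wedhorn, §(5.2)). Hence `AlgPoints.nonempty_iff`:
  **for `X` locally of finite type, `X(L) ≠ ∅ ↔ X ≠ ∅`**, and the specialisation
  `ComplexPoints_nonempty` / `ComplexPoints_nonempty_iff` (registered as an instance, so that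
  `Nonempty (ComplexPoints S)` is found for `S` smooth over `ℂ` with `IrreducibleSpace S.left`,
  `ComplexPoints_nonempty_of_smooth`).
* The finite-type hypothesis is sharp (Görtz–Wedhorn, Example 5.2): `Spec ℂ(t)` is a non-empty
  `ℂ`-scheme without complex points, `ComplexPoints_isEmpty_specOver_ratFunc`.
* Unconditional explicit inhabitants: `𝟙 ∈ (Spec L)(L)` (`AlgPoints.instNonemptySpecOver`,
  `ComplexPoints_nonempty_specOver`).

**Arbitrary fields `L`** (section `GeneralFields`, the carrier `AlgPoints X L` itself): the census
statement `∀ X L, Nonempty (AlgPoints X L)` is **false** (`AlgPoints_not_forall_nonempty`); the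
exact region is Görtz–Wedhorn Prop. 3.8, `AlgPoints.nonempty_iff_exists_residueField`
(`X(L) ≠ ∅ ↔` some residue field `κ(x)` embeds into `L` over `k`), with
`AlgPoints.forall_isEmpty_iff` (`X(L) = ∅` for all `L` iff `X = ∅`) and
`AlgPoints.nonempty_specOver_iff` (`(Spec K)(L) = Hom_k(K, L)`, so e.g. `(Spec ℂ)(ℝ) = ∅` over
`ℝ`, `AlgPoints_isEmpty_realPoints_specComplex`: finite type does not help for `L` not
algebraically closed). Unconditional inhabitants registered as instances: the unit `Spec k`,
`specOver k k`, affine space `𝔸^σ_k` (the origin) and projective space `ℙⁿ_k` (`[1 : ⋯ : 1]`,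
Hartshorne II Thm. 7.1) for every `L ⊇ k`; extension of scalars along a tower `k → K → L`
(`AlgPoints.nonempty_of_isScalarTower`, `AlgPoints.nonempty_of_rationalPoint`); and
`IsSmoothProjective.nonempty_algPoints` for `L` algebraically closed.

Everything is proved; no named fact is introduced.

## References

* U. Görtz, T. Wedhorn, *Algebraic Geometry I: Schemes*, 2nd ed. (2020): Prop. 3.35, Cor. 3.36
  (closed points of a scheme locally of finite type over a field; over an algebraically closed
  field they are the rational points), §(4.1)/(5.2) (`X(K) = X_k(K) = Hom_k(Spec K, X)`),
  Example 5.2 (`Spec k'` has no `k`-point), Prop. 3.8 (`Hom(Spec K, X) = {(x, κ(x) → K)}`),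
  Example 5.3 (`ℙⁿ(K)`). [GortzWedhorn2020]
* R. Hartshorne, *Algebraic Geometry*, II Ex. 2.7, II.3, II Thm. 7.1 (morphisms to `ℙⁿ`).
  [Hartshorne1977]
-/

universe u

open CategoryTheory CategoryTheory.Limits AlgebraicGeometry

noncomputable section

namespace Literature.AlgebraicGeometry.Motives

variable {k : Type u} [Field k]

namespace AlgPoints

variable (X : SchemeOver k) (L : Type u) [Field L] [Algebra k L]

/-! ### The vacuous region: schemes with empty underlying space -/

/-- An `L`-point of `X` has an underlying point of `X` (the image of the unique point of
`Spec L`), so `X(L) ≠ ∅ ⇒ X ≠ ∅`. [cite: GortzWedhorn2020, §(5.2)] -/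
theorem nonempty_left_of_nonempty (h : Nonempty (AlgPoints X L)) : Nonempty X.left :=
  h.map AlgPoints.pt

/-- **`X = ∅ ⇒ X(L) = ∅`**: a scheme with empty underlying space has no `L`-points (every
statement `∀ P : X(L), …` is then vacuous). [cite: GortzWedhorn2020, §(5.2)] -/
theorem isEmpty_of_isEmpty (h : IsEmpty X.left) : IsEmpty (AlgPoints X L) :=
  ⟨fun P ↦ h.false P.pt⟩

/-- Instance form of `isEmpty_of_isEmpty`. [cite: GortzWedhorn2020, §(5.2)] -/
instance instIsEmptyOfIsEmptyLeft [h : IsEmpty X.left] : IsEmpty (AlgPoints X L) :=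
  isEmpty_of_isEmpty X L h

/-! ### Unconditional explicit inhabitants -/

/-- `(Spec L)(L) ∋ id` for every `k`-algebra `L` which is a field: the tautological `L`-point of
`Spec L` over `k` is the identity. [cite: GortzWedhorn2020, §(4.1)] -/
instance instNonemptySpecOver : Nonempty (AlgPoints (specOver k L) L) := ⟨𝟙 (specOver k L)⟩

/-! ### Hilbert's Nullstellensatz: non-empty schemes locally of finite type have `L`-points -/

variable [IsAlgClosed L]

/-- **Hilbert's Nullstellensatz, point form.** Let `k ⊆ L` with `L` algebraically closed and let
`X` be a non-empty `k`-scheme locally of finite type. Then `X(L) ≠ ∅`.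
Proof as in the books: `X(L) = X_L(L)` for the base change `X_L = X ×ₖ Spec L → Spec L`
(Görtz–Wedhorn §(5.2)), which is locally of finite type (base change) and non-empty
(`Spec L → Spec k` is surjective, Mathlib `Scheme.Pullback.exists_preimage_pullback`); a scheme
locally of finite type over a field is a Jacobson space, so it has a closed point
(Görtz–Wedhorn Prop. 3.35, Mathlib `LocallyOfFiniteType.jacobsonSpace`,
`nonempty_inter_closedPoints`), and over an algebraically closed field closed points are rational
(Görtz–Wedhorn Cor. 3.36, Mathlib `pointOfClosedPoint`).
[cite: GortzWedhorn2020, Prop. 3.35, Cor. 3.36 and §(5.2)] -/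
theorem nonempty_of_locallyOfFiniteType [LocallyOfFiniteType X.hom] [h : Nonempty X.left] :
    Nonempty (AlgPoints X L) := by
  obtain ⟨x⟩ := h
  -- the structure map `g : Spec L → Spec k` and the base change `X_L = X ×ₖ Spec L`
  obtain ⟨g, hg⟩ : ∃ g : Spec (.of L) ⟶ Spec (.of k),
      g = Spec.map (CommRingCat.ofHom (algebraMap k L)) := ⟨_, rfl⟩
  haveI : JacobsonSpace ↥(pullback X.hom g) :=
    LocallyOfFiniteType.jacobsonSpace (pullback.snd X.hom g)
  -- `X_L ≠ ∅`: a point over `x ∈ X` and the point of `Spec L`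
  obtain ⟨z, -, -⟩ := Scheme.Pullback.exists_preimage_pullback (f := X.hom) (g := g) x default
    (Subsingleton.elim _ _)
  -- a closed point `y ∈ X_L`; it is `L`-rational: `Spec L → X_L` over `Spec L`
  obtain ⟨y, -, hy⟩ := nonempty_inter_closedPoints (X := ↥(pullback X.hom g))
    ⟨z, Set.mem_univ z⟩ isClosed_univ.isLocallyClosed
  refine ⟨AlgPoints.mk (pointOfClosedPoint (pullback.snd X.hom g) y hy ≫ pullback.fst X.hom g) ?_⟩
  rw [Category.assoc, pullback.condition, pointOfClosedPoint_comp_assoc, hg]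

/-- Instance form of `nonempty_of_locallyOfFiniteType` (fires e.g. for `X` smooth over `k` with
`IrreducibleSpace X.left`). [cite: GortzWedhorn2020, Prop. 3.35, Cor. 3.36 and §(5.2)] -/
instance instNonemptyOfLocallyOfFiniteType [LocallyOfFiniteType X.hom] [Nonempty X.left] :
    Nonempty (AlgPoints X L) :=
  nonempty_of_locallyOfFiniteType X L

/-- **Exact criterion** for schemes locally of finite type over `k` and `L ⊇ k` algebraically
closed: `X(L) ≠ ∅ ↔ X ≠ ∅`. [cite: GortzWedhorn2020, Prop. 3.35, Cor. 3.36 and §(5.2)] -/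
theorem nonempty_iff [LocallyOfFiniteType X.hom] : Nonempty (AlgPoints X L) ↔ Nonempty X.left :=
  ⟨nonempty_left_of_nonempty X L, fun _ ↦ nonempty_of_locallyOfFiniteType X L⟩

/-- **Exact vacuous region** for schemes locally of finite type over `k` and `L ⊇ k`
algebraically closed: `X(L) = ∅ ↔ X = ∅`. [cite: GortzWedhorn2020, Prop. 3.35, Cor. 3.36 and §(5.2)] -/
theorem isEmpty_iff [LocallyOfFiniteType X.hom] : IsEmpty (AlgPoints X L) ↔ IsEmpty X.left := by
  rw [← not_nonempty_iff, ← not_nonempty_iff, nonempty_iff]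

end AlgPoints

/-! ### Complex points -/

section Complex

variable {k : Type} [Field k] [Algebra k ℂ] (X : SchemeOver k)

/-- **`X = ∅ ⇒ X(ℂ) = ∅`** (the vacuous region of the carrier `ComplexPoints`): over a `k`-scheme
with empty underlying space every item `∀ s : ComplexPoints X, …` holds vacuously and every item
`∃ s : ComplexPoints X, …` fails. [cite: GortzWedhorn2020, §(5.2)] -/
theorem ComplexPoints_isEmpty (h : IsEmpty X.left) : IsEmpty (ComplexPoints X) :=
  AlgPoints.isEmpty_of_isEmpty X ℂ h

/-- The empty `k`-scheme `∅ → Spec k` has no complex points. [cite: GortzWedhorn2020, §(5.2)] -/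
theorem ComplexPoints_isEmpty_empty :
    IsEmpty (ComplexPoints (Over.mk (Scheme.emptyTo (Spec (.of k))) : SchemeOver k)) :=
  ComplexPoints_isEmpty _ (inferInstanceAs (IsEmpty ↥(∅ : Scheme.{0})))

/-- `X(ℂ) ≠ ∅ ⇒ X ≠ ∅`. [cite: GortzWedhorn2020, §(5.2)] -/
theorem nonempty_left_of_nonempty_complexPoints (h : Nonempty (ComplexPoints X)) :
    Nonempty X.left :=
  AlgPoints.nonempty_left_of_nonempty X ℂ h

/-- **Carrier witness (Hilbert's Nullstellensatz over `ℂ`).** For every field `k` with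
`[Algebra k ℂ]` and every non-empty `k`-scheme `X` locally of finite type, `X(ℂ) ≠ ∅`
(`AlgPoints.nonempty_of_locallyOfFiniteType` with `L = ℂ`, Mathlib `Complex.isAlgClosed`).
[cite: GortzWedhorn2020, Prop. 3.35, Cor. 3.36 and §(5.2)] -/
theorem ComplexPoints_nonempty :
    ∀ {k : Type} [Field k] [Algebra k ℂ] (X : SchemeOver k) [LocallyOfFiniteType X.hom]
      [Nonempty X.left], Nonempty (ComplexPoints X) :=
  fun X ↦ AlgPoints.nonempty_of_locallyOfFiniteType X ℂ

/-- Instance form of `ComplexPoints_nonempty`. [cite: GortzWedhorn2020, Prop. 3.35, Cor. 3.36 and §(5.2)] -/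
instance ComplexPoints.instNonempty [LocallyOfFiniteType X.hom] [Nonempty X.left] :
    Nonempty (ComplexPoints X) :=
  ComplexPoints_nonempty X

/-- **Exact criterion for `X` locally of finite type: `X(ℂ) ≠ ∅ ↔ X ≠ ∅`.**
[cite: GortzWedhorn2020, Prop. 3.35, Cor. 3.36 and §(5.2)] -/
theorem ComplexPoints_nonempty_iff [LocallyOfFiniteType X.hom] :
    Nonempty (ComplexPoints X) ↔ Nonempty X.left :=
  AlgPoints.nonempty_iff X ℂ

/-- **Exact vacuous region for `X` locally of finite type: `X(ℂ) = ∅ ↔ X = ∅`.**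
[cite: GortzWedhorn2020, Prop. 3.35, Cor. 3.36 and §(5.2)] -/
theorem ComplexPoints_isEmpty_iff [LocallyOfFiniteType X.hom] :
    IsEmpty (ComplexPoints X) ↔ IsEmpty X.left :=
  AlgPoints.isEmpty_iff X ℂ

/-- The shape in which the route items meet the carrier: a `ℂ`-scheme `S` smooth over `ℂ` with
irreducible (hence non-empty) underlying space has a complex point (smooth ⇒ locally of finite
presentation ⇒ locally of finite type; found by instance resolution).
[cite: GortzWedhorn2020, Prop. 3.35, Cor. 3.36 and §(5.2)] -/
theorem ComplexPoints_nonempty_of_smooth (S : SchemeOver ℂ) [Smooth S.hom] [IrreducibleSpace S.left] :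
    Nonempty (ComplexPoints S) :=
  inferInstance

/-- `(Spec ℂ)(ℂ) ∋ id` over any `k ⊆ ℂ`: an unconditional explicit inhabitant.
[cite: GortzWedhorn2020, §(4.1)] -/
theorem ComplexPoints_nonempty_specOver : Nonempty (ComplexPoints (specOver k ℂ)) :=
  ⟨𝟙 (specOver k ℂ)⟩

/-! ### Sharpness of the finite-type hypothesis -/

/-- There is no `ℂ`-algebra homomorphism `ℂ(t) → ℂ`: it would be injective (a ring map out of a
field) and send both `t` and the constant `c := image of t` to `c`.
[cite: GortzWedhorn2020, Example 5.2] -/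
theorem isEmpty_ratFunc_algHom_complex : IsEmpty (RatFunc ℂ →ₐ[ℂ] ℂ) := by
  refine ⟨fun φ ↦ ?_⟩
  have hinj : Function.Injective φ := φ.toRingHom.injective
  have h : φ RatFunc.X = φ (RatFunc.C (φ RatFunc.X)) := by
    rw [← RatFunc.algebraMap_eq_C, AlgHom.commutes, Algebra.algebraMap_self, RingHom.id_apply]
  have hX : (RatFunc.X : RatFunc ℂ) = RatFunc.C (φ RatFunc.X) := hinj h
  have hnum := congrArg RatFunc.num hX
  rw [RatFunc.num_X, RatFunc.num_C] at hnum
  have hdeg := congrArg Polynomial.natDegree hnum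
  rw [Polynomial.natDegree_X, Polynomial.natDegree_C] at hdeg
  exact one_ne_zero hdeg

/-- **The finite-type hypothesis in `ComplexPoints_nonempty` cannot be dropped**
(Görtz–Wedhorn, Example 5.2: `Spec k'` for a non-trivial extension `k'/k` has no `k`-point):
the `ℂ`-scheme `Spec ℂ(t)` is non-empty but has no complex point, since a complex point
`Spec ℂ → Spec ℂ(t)` over `Spec ℂ` is `Spec` of a `ℂ`-algebra map `ℂ(t) → ℂ`
(`Spec` is fully faithful), and there is none (`isEmpty_ratFunc_algHom_complex`).
[cite: GortzWedhorn2020, Example 5.2] -/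
theorem ComplexPoints_isEmpty_specOver_ratFunc :
    Nonempty (specOver ℂ (RatFunc ℂ)).left ∧ IsEmpty (ComplexPoints (specOver ℂ (RatFunc ℂ))) := by
  refine ⟨⟨(default : Spec (.of (RatFunc ℂ)))⟩, ⟨fun P ↦ ?_⟩⟩
  -- the ring map `ψ : ℂ(t) → ℂ` with `Spec ψ = P`
  let ψ : CommRingCat.of (RatFunc ℂ) ⟶ CommRingCat.of ℂ := Spec.preimage P.left
  have hψ : Spec.map ψ = P.left := Spec.map_preimage P.left
  -- compatibility with the structure maps: `ψ ∘ (ℂ → ℂ(t)) = id`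
  have hw : Spec.map (CommRingCat.ofHom (algebraMap ℂ (RatFunc ℂ)) ≫ ψ) =
      Spec.map (CommRingCat.ofHom (algebraMap ℂ ℂ)) := by
    rw [Spec.map_comp, hψ]
    exact Over.w P
  have hcomp : CommRingCat.ofHom (algebraMap ℂ (RatFunc ℂ)) ≫ ψ =
      CommRingCat.ofHom (algebraMap ℂ ℂ) := Spec.map_injective hw
  have hc : ∀ c : ℂ, ψ.hom (algebraMap ℂ (RatFunc ℂ) c) = c := fun c ↦
    RingHom.congr_fun (congrArg CommRingCat.Hom.hom hcomp) c
  -- so `ψ` is a `ℂ`-algebra map `ℂ(t) → ℂ`, which does not exist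
  exact isEmpty_ratFunc_algHom_complex.false
    { toRingHom := ψ.hom, commutes' := fun c ↦ by simpa using hc c }

end Complex

/-! ## Arbitrary fields `L`: exact region, more inhabitants, and the census statement for `AlgPoints`

(unit `libB-HodgeConjecture-19`, carrier `AlgPoints`; the sections above came with the `ComplexPoints` unit.) -/

section GeneralFields

open MonoidalCategory

namespace AlgPoints

variable (X : SchemeOver k) (L : Type u) [Field L] [Algebra k L]

/-! ### Arbitrary fields `L`: the exact region (Görtz–Wedhorn, Prop. 3.8) -/

/-- **`X(L)` in terms of points and residue fields** (Görtz–Wedhorn, Prop. 3.8 with §(5.2)): an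
`L`-point of `X` over `k` is the same as a point `x ∈ X` together with a ring map `ι : κ(x) → L`
such that `Spec L → Spec κ(x) → X → Spec k` is the structure map of `L`, i.e. a `k`-embedding
`κ(x) ↪ L`. Hence `X(L) ≠ ∅` iff some residue field of `X` embeds into `L` over `k` — the exact
(arithmetic) region of non-emptiness for a general field `L`; the bijection itself is Mathlib's
`Scheme.SpecToEquivOfField`. [cite: GortzWedhorn2020, Prop. 3.8 and §(5.2)] -/
theorem nonempty_iff_exists_residueField :
    Nonempty (AlgPoints X L) ↔ ∃ (x : X.left) (ι : X.left.residueField x ⟶ CommRingCat.of L),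
      Spec.map ι ≫ X.left.fromSpecResidueField x ≫ X.hom =
        Spec.map (CommRingCat.ofHom (algebraMap k L)) := by
  constructor
  · rintro ⟨P⟩
    refine ⟨P.pt, P.resHom, ?_⟩
    have h : Spec.map P.resHom ≫ X.left.fromSpecResidueField P.pt = P.left := by
      change (X.left.SpecToEquivOfField L).symm (X.left.SpecToEquivOfField L P.left) = P.left
      exact Equiv.symm_apply_apply _ _
    rw [← Category.assoc, h]
    exact Over.w P
  · rintro ⟨x, ι, h⟩
    exact ⟨AlgPoints.mk (Spec.map ι ≫ X.left.fromSpecResidueField x) (by rw [Category.assoc, h])⟩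

/-- **`X(L) = ∅` for every field `L ⊇ k` iff `X = ∅`**: if `x ∈ X`, then `X` has a point with
values in the residue field `L := κ(x)` (a `k`-algebra through `Spec κ(x) → X → Spec k`), namely
the canonical morphism `i_x : Spec κ(x) → X` (Görtz–Wedhorn, §(3.4) and Prop. 3.8). So the region where
*all* the carriers `AlgPoints X L` are empty is exactly the empty scheme.
[cite: GortzWedhorn2020, Prop. 3.8 and §(5.2)] -/
theorem forall_isEmpty_iff :
    (∀ (L : Type u) [Field L] [Algebra k L], IsEmpty (AlgPoints X L)) ↔ IsEmpty X.left := by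
  refine ⟨fun h ↦ ⟨fun x ↦ ?_⟩, fun hX L _ _ ↦ isEmpty_of_isEmpty X L hX⟩
  letI : Algebra k (X.left.residueField x) :=
    (Spec.preimage (X.left.fromSpecResidueField x ≫ X.hom)).hom.toAlgebra
  exact (h (X.left.residueField x)).false
    (AlgPoints.mk (X.left.fromSpecResidueField x)
      (by rw [RingHom.algebraMap_toAlgebra, CommRingCat.ofHom_hom, Spec.map_preimage]))

/-! ### Points of `Spec K`: field embeddings (Görtz–Wedhorn, Example 5.2) -/

section SpecOver

variable (K : Type u) [Field K] [Algebra k K]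

/-- **`(Spec K)(L) ≠ ∅ ↔` there is a `k`-algebra map `K → L`**: an `L`-point of the `k`-scheme
`Spec K` is `Spec` of a `k`-algebra homomorphism `K → L` (`Spec` is fully faithful,
Görtz–Wedhorn, Prop. 3.4 and §(4.1)); in particular `X = Spec K` is a *non-empty* `k`-scheme with
`X(L) = ∅` as soon as `K` has no `k`-embedding into `L` (Görtz–Wedhorn, Example 5.2:
"`X(k)` might be empty"). [cite: GortzWedhorn2020, §(4.1) and Example 5.2] -/
theorem nonempty_specOver_iff :
    Nonempty (AlgPoints (specOver k K) L) ↔ Nonempty (K →ₐ[k] L) := by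
  constructor
  · rintro ⟨P⟩
    have h₁ : Spec.map (Spec.preimage P.left) ≫ Spec.map (CommRingCat.ofHom (algebraMap k K)) =
        Spec.map (CommRingCat.ofHom (algebraMap k L)) := by
      rw [Spec.map_preimage]
      exact Over.w P
    rw [← Spec.map_comp] at h₁
    have h₂ := Spec.map_injective h₁
    exact ⟨{ (Spec.preimage P.left).hom with
      commutes' := fun c ↦ by
        simpa using congrArg (fun f : CommRingCat.of k ⟶ CommRingCat.of L ↦ f.hom c) h₂ }⟩
  · rintro ⟨e⟩
    refine ⟨AlgPoints.mk (Spec.map (CommRingCat.ofHom e.toRingHom)) ?_⟩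
    change Spec.map _ ≫ Spec.map _ = Spec.map _
    rw [← Spec.map_comp, ← CommRingCat.ofHom_comp, AlgHom.toRingHom_eq_coe, AlgHom.comp_algebraMap]

/-- `(Spec K)(L) = ∅` when `K` admits no `k`-algebra map to `L` (Görtz–Wedhorn, Example 5.2).
[cite: GortzWedhorn2020, Example 5.2] -/
theorem isEmpty_specOver [h : IsEmpty (K →ₐ[k] L)] : IsEmpty (AlgPoints (specOver k K) L) := by
  rw [← not_nonempty_iff, nonempty_specOver_iff]
  exact not_nonempty_iff.mpr h

end SpecOver

/-! ### More unconditional inhabitants -/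

/-- `(Spec k)(L) ∋` the structure map, for the monoidal unit `𝟙_ (SchemeOver k) = Spec k`
(the terminal `k`-scheme: `X(L) → (Spec k)(L) = {pt}`). [cite: GortzWedhorn2020, §(4.1)] -/
instance instNonemptyTensorUnit : Nonempty (AlgPoints (𝟙_ (SchemeOver k)) L) :=
  ⟨CartesianMonoidalCategory.toUnit _⟩

/-- **Extension of scalars**: for a tower of fields `k → K → L`, composing with
`Spec L → Spec K` maps `X(K) → X(L)`; in particular `X(K) ≠ ∅ ⇒ X(L) ≠ ∅`
(Görtz–Wedhorn, §(5.2): `X(K) ↪ X(L)` along `K ↪ L`). [cite: GortzWedhorn2020, §(5.2)] -/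
theorem nonempty_of_isScalarTower (K : Type u) [Field K] [Algebra k K] [Algebra K L]
    [IsScalarTower k K L] [h : Nonempty (AlgPoints X K)] : Nonempty (AlgPoints X L) := by
  obtain ⟨P⟩ := h
  refine ⟨(Over.homMk (Spec.map (CommRingCat.ofHom (algebraMap K L))) ?_ :
    specOver k L ⟶ specOver k K) ≫ P⟩
  change Spec.map _ ≫ Spec.map _ = Spec.map _
  rw [← Spec.map_comp, ← CommRingCat.ofHom_comp, ← IsScalarTower.algebraMap_eq k K L]

/-- **A `k`-rational point gives an `L`-point for every `L ⊇ k`** (extension of scalars along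
`k → L`). [cite: GortzWedhorn2020, §(5.1) and §(5.2)] -/
theorem nonempty_of_rationalPoint (P : AlgPoints X k) : Nonempty (AlgPoints X L) :=
  haveI : Nonempty (AlgPoints X k) := ⟨P⟩
  nonempty_of_isScalarTower X L k

/-- `(Spec k)(L) ∋` the structure map `Spec L → Spec k`, for `Spec k` written as `specOver k k`.
[cite: GortzWedhorn2020, §(4.1)] -/
instance instNonemptySpecOverSelf : Nonempty (AlgPoints (specOver k k) L) :=
  nonempty_of_rationalPoint _ L (𝟙 (specOver k k))

/-- **`𝔸^σ(L) ∋ 0`**: the origin of affine space, i.e. the `k`-morphism `Spec L → 𝔸^σ_k` with all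
coordinate functions `0` (Mathlib `AffineSpace.homOfVector`; `𝔸^σ(L) = L^σ`,
Görtz–Wedhorn (4.1)/(5.2) with `A = k[Tᵢ]`). [cite: GortzWedhorn2020, §(5.2)] -/
instance instNonemptyAffineSpace (σ : Type u) :
    Nonempty (AlgPoints (Over.mk (𝔸(σ; Spec (.of k)) ↘ Spec (.of k)) : SchemeOver k) L) :=
  ⟨AlgPoints.mk (AffineSpace.homOfVector (Spec.map (CommRingCat.ofHom (algebraMap k L))) 0)
    (AffineSpace.homOfVector_over _ _)⟩

/-! ### Projective space: the point `[1 : ⋯ : 1] ∈ ℙⁿ(L)` -/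

section ProjectiveSpace

open MvPolynomial (homogeneousSubmodule)

attribute [local instance] MvPolynomial.gradedAlgebra

variable (n : ℕ)

/-- The ring map `F ↦ F(1, …, 1)` from `k[x₀, …, xₙ]` to `Γ(Spec L, ⊤) = L`. [folklore] -/
private def evalOnesToΓ : MvPolynomial (Fin (n + 1)) k →+* Γ(Spec (.of L), ⊤) :=
  (Scheme.ΓSpecIso (.of L)).commRingCatIsoToRingEquiv.symm.toRingHom.comp
    (MvPolynomial.aeval fun _ : Fin (n + 1) ↦ (1 : L)).toRingHom

/-- `evalOnesToΓ F` is `F(1, …, 1)` transported to `Γ(Spec L, ⊤)` along `ΓSpecIso`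
(unfolding, `rfl`). [folklore] -/
private theorem evalOnesToΓ_apply (F : MvPolynomial (Fin (n + 1)) k) :
    evalOnesToΓ (k := k) L n F =
      (Scheme.ΓSpecIso (.of L)).inv (MvPolynomial.aeval (fun _ : Fin (n + 1) ↦ (1 : L)) F) :=
  rfl

/-- At `(1, …, 1)` the irrelevant ideal `(x₀, …, xₙ)` generates the unit ideal (`x₀ ↦ 1`): the
hypothesis of Mathlib's `Proj.fromOfGlobalSections`. [cite: Hartshorne1977, II Thm. 7.1] -/
private theorem irrelevant_map_evalOnesToΓ :
    (HomogeneousIdeal.irrelevant (homogeneousSubmodule (Fin (n + 1)) k)).toIdeal.map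
      (evalOnesToΓ (k := k) L n) = ⊤ := by
  refine Ideal.eq_top_of_isUnit_mem _ (Ideal.mem_map_of_mem _ (x := MvPolynomial.X 0) ?_) ?_
  · rw [HomogeneousIdeal.mem_iff, HomogeneousIdeal.mem_irrelevant_iff, GradedRing.proj_apply,
      DirectSum.decompose_of_mem_ne (homogeneousSubmodule (Fin (n + 1)) k)
        (MvPolynomial.isHomogeneous_X k 0) one_ne_zero]
  · rw [evalOnesToΓ_apply, MvPolynomial.aeval_X]
    exact isUnit_one.map _

/-- The morphism `Spec L → ℙⁿ_k` with homogeneous coordinates `(1 : ⋯ : 1)` lies over `Spec k`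
(Mathlib `Proj.fromOfGlobalSections_toSpecZero`). [cite: Hartshorne1977, II Thm. 7.1] -/
private theorem fromOfGlobalSections_evalOnesToΓ_comp_hom :
    Proj.fromOfGlobalSections (homogeneousSubmodule (Fin (n + 1)) k) (evalOnesToΓ (k := k) L n)
        (irrelevant_map_evalOnesToΓ L n) ≫ (projectiveSpace n k).hom =
      Spec.map (CommRingCat.ofHom (algebraMap k L)) := by
  change _ ≫ (Proj.toSpecZero (homogeneousSubmodule (Fin (n + 1)) k) ≫
    Spec.map (CommRingCat.ofHom (algebraMap k (homogeneousSubmodule (Fin (n + 1)) k 0)))) = _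
  rw [Proj.fromOfGlobalSections_toSpecZero_assoc, ← Spec.map_comp, ← CommRingCat.ofHom_comp,
    RingHom.comp_assoc]
  have h₁ :
      (algebraMap (homogeneousSubmodule (Fin (n + 1)) k 0) (MvPolynomial (Fin (n + 1)) k)).comp
        (algebraMap k (homogeneousSubmodule (Fin (n + 1)) k 0)) = MvPolynomial.C :=
    RingHom.ext fun c ↦ by simp
  have h₂ : (evalOnesToΓ (k := k) L n).comp MvPolynomial.C =
      (Scheme.ΓSpecIso (.of L)).inv.hom.comp (algebraMap k L) := by
    ext c
    simp [evalOnesToΓ_apply]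
  rw [h₁, h₂, CommRingCat.ofHom_comp, CommRingCat.ofHom_hom, Spec.map_comp,
    toSpecΓ_SpecMap_ΓSpecIso_inv_assoc]

/-- **`ℙⁿ(L) ∋ [1 : ⋯ : 1]`** for every field `L ⊇ k`: the `k`-morphism `Spec L → ℙⁿ_k`
given by the global sections `1, …, 1` of `𝒪_{Spec L}`, which generate it (Hartshorne II
Thm. 7.1 (b); Mathlib `Proj.fromOfGlobalSections`); `ℙⁿ(L) = (Lⁿ⁺¹ ∖ 0)/Lˣ ≠ ∅`
(Görtz–Wedhorn, Example 5.3). The full dictionary `ℙⁿ(L) ↔ (Lⁿ⁺¹ ∖ 0)/Lˣ` is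
`ProjectiveSpace.pointOfVec` (`Motives/ProjectiveSpaceFieldPoints`, not imported here to keep this
file's import cone at `AlgPoints`).
[cite: Hartshorne1977, II Thm. 7.1] [cite: GortzWedhorn2020, Example 5.3] -/
instance instNonemptyProjectiveSpace : Nonempty (AlgPoints (projectiveSpace n k) L) :=
  ⟨AlgPoints.mk
    (Proj.fromOfGlobalSections (homogeneousSubmodule (Fin (n + 1)) k) (evalOnesToΓ L n)
      (irrelevant_map_evalOnesToΓ L n))
    (fromOfGlobalSections_evalOnesToΓ_comp_hom L n)⟩

end ProjectiveSpace

end AlgPoints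

/-- **A smooth projective variety has a point in every algebraically closed field `L ⊇ k`**:
it is geometrically irreducible, so non-empty, and locally of finite type (smooth), so
`AlgPoints.nonempty_of_locallyOfFiniteType` (Hilbert's Nullstellensatz) applies. In particular a
complex smooth projective variety — e.g. a smooth projective curve `C/ℂ` — has a complex point.
[cite: GortzWedhorn2020, Prop. 3.35, Cor. 3.36 and §(5.2)] -/
theorem IsSmoothProjective.nonempty_algPoints {n : ℕ} {X : SchemeOver k}
    (hX : IsSmoothProjective n X) (L : Type u) [Field L] [Algebra k L] [IsAlgClosed L] :
    Nonempty (AlgPoints X L) := by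
  haveI := hX.smoothOfRelativeDimension
  haveI : Smooth X.hom := SmoothOfRelativeDimension.smooth n X.hom
  haveI := hX.geometricallyIrreducible
  haveI : IrreducibleSpace X.left :=
    GeometricallyIrreducible.irreducibleSpace_of_subsingleton X.hom
  exact AlgPoints.nonempty_of_locallyOfFiniteType X L

/-! ### The census statement for the carrier `AlgPoints`, decided -/

/-- The empty `k`-scheme `∅ → Spec k` has no `L`-points, for every `L`
(the vacuous region of the carrier `AlgPoints`). [cite: GortzWedhorn2020, §(5.2)] -/
theorem AlgPoints_isEmpty_empty (L : Type u) [Field L] [Algebra k L] :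
    IsEmpty (AlgPoints (Over.mk (Scheme.emptyTo (Spec (.of k))) : SchemeOver k) L) :=
  AlgPoints.isEmpty_of_isEmpty _ L (inferInstanceAs (IsEmpty ↥(∅ : Scheme.{u})))

/-- **FINDING: `∀ X L, Nonempty (AlgPoints X L)` is false** over every base field `k` (already
`X = ∅` is a counterexample; `AlgPoints.isEmpty_specOver` gives non-empty ones). Items binding
`∀ P : AlgPoints X L, …` are vacuous exactly over the region described by
`AlgPoints.nonempty_iff_exists_residueField`. [cite: GortzWedhorn2020, §(5.2) and Example 5.2] -/
theorem AlgPoints_not_forall_nonempty :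
    ¬ ∀ (X : SchemeOver k) (L : Type u) [Field L] [Algebra k L], Nonempty (AlgPoints X L) :=
  fun h ↦ (AlgPoints_isEmpty_empty (k := k) k).false (Classical.choice (h _ k))

/-- There is no ring (= `ℝ`-algebra) homomorphism `ℂ → ℝ`: the image of `i` would be a square
root of `-1` in `ℝ`. [folklore] -/
theorem isEmpty_complex_algHom_real : IsEmpty (ℂ →ₐ[ℝ] ℝ) := by
  refine ⟨fun f ↦ ?_⟩
  have h : f Complex.I ^ 2 = -1 := by
    rw [← map_pow, Complex.I_sq, map_neg, map_one]
  nlinarith [sq_nonneg (f Complex.I)]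

/-- **Finite type does not help when `L` is not algebraically closed**: the `ℝ`-scheme `Spec ℂ`
(a closed point of `ℙ¹_ℝ`; non-empty, finite étale over `ℝ`) has no real point, since a real
point would be `Spec` of an `ℝ`-algebra map `ℂ → ℝ` (Görtz–Wedhorn, Example 5.2 with
`k'/k = ℂ/ℝ`). For a general field `L` emptiness of `X(L)` is an arithmetic condition
(`AlgPoints.nonempty_iff_exists_residueField`), not a geometric one.
[cite: GortzWedhorn2020, Example 5.2] -/
theorem AlgPoints_isEmpty_realPoints_specComplex :
    Nonempty (specOver ℝ ℂ).left ∧ IsEmpty (AlgPoints (specOver ℝ ℂ) ℝ) :=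
  ⟨⟨(default : Spec (.of ℂ))⟩,
    haveI := isEmpty_complex_algHom_real
    AlgPoints.isEmpty_specOver ℝ ℂ⟩

end GeneralFields

end Literature.AlgebraicGeometry.Motives

end
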